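import Mathlib
import Literature.LinearAlgebra.Matrix.RankMinors
import Literature.Computability.AlgebraicComplexity.DeterminantalComplexityProofs
import Summits.ValiantsHypothesis.ValiantsHypothesis.Theorems.BarrierLeverDefinableEquationsProductDepthWall
import Summits.ValiantsHypothesis.ValiantsHypothesis.Theorems.BarrierLeverDefinableEquationsBlockPlacement

/-!
# Route BarrierLever — crux `DefinableEquations` (stmt-8745) / item `SingleSizeEquations`
# (stmt-8749): preliminaries for the LST-UNIVERSAL small circuit (val-np-p5 g10; part 1 of 2)

Tools for `…ProductDepthWallUniversal.lean` (the LST wall for UNION certificates):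
* §1 `aeval_immPoly_pad` — `IMM_{n,n'}` with identity matrices substituted on the layers `t ≥ d`
  is `IMM_{n,d}` (a product over `List.range` with trailing `1`s, `prod_map_range_eq_of_eq_one`);
* §2 affine forms: every polynomial of total degree `≤ 1` is `Σ_v c_v x_v + c_0`
  (`eq_affine_of_totalDegree_le_one`), affine forms have degree `≤ 1` and complexity `≤ 2n+1`;
  LST's substitution `ρ_w` placed by an embedding `e` and padded by identity layers turns
  `IMM_{n,n}` into the placed word polynomial `e_*(P_w)` (`aeval_placedSubst_immPoly`), hence some
  AFFINE coefficient tensor does (`exists_affine_specialisation`).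
No definitions, no named facts, standard axioms.  Refs: Limaye–Srinivasan–Tavenas, J. ACM 72
(2025) §2.2, Lemma 8; Bürgisser 2000 §2.1.
-/

-- `Summit.ValiantsHypothesis.ValiantsHypothesis.…` repeats a component by the D-0017 layout
-- (single-conjunct summit), which the `dupNamespace` linter flags; the name is mandated.
set_option linter.dupNamespace false

noncomputable section

namespace Summit.ValiantsHypothesis.ValiantsHypothesis.Theorems.BarrierLeverDefinableEquations

open MvPolynomial
open Literature.Computability.AlgebraicComplexity
open Literature.Computability.AlgebraicComplexity.LSTWord
open Literature.Barriers.ValiantsHypothesis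
open scoped BigOperators

namespace ProductDepthWallUniversal

/-! ## §1 `IMM` with trailing identity layers -/

section Padding

variable {K : Type*} [CommRing K] {S : Type*} [CommRing S] [Algebra K S]

/-- A product over `List.range (d + j)` whose factors beyond `d` are `1` equals the product over
`List.range d`. [folklore] -/
theorem prod_map_range_eq_of_eq_one {M : Type*} [Monoid M] (F : ℕ → M) (d : ℕ) :
    ∀ j : ℕ, (∀ t, d ≤ t → t < d + j → F t = 1) →
      ((List.range (d + j)).map F).prod = ((List.range d).map F).prod
  | 0, _ => by simp
  | j + 1, h => by
    rw [← add_assoc, List.range_succ, List.map_append, List.prod_append, List.map_singleton,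
      List.prod_singleton, h (d + j) (by omega) (by omega), mul_one]
    exact prod_map_range_eq_of_eq_one F d j fun t ht ht' => h t ht (by omega)

/-- **Padding by identity layers**: if the substitution `g` sends every layer `t ≥ d` of
`IMM_{n,n'}` (`d ≤ n'`) to the identity matrix, then `g(IMM_{n,n'}) = g|_{<d}(IMM_{n,d})`.
[cite: LimayeSrinivasanTavenas2025, §2.2] -/
theorem aeval_immPoly_pad {n n' d : ℕ} (hd : d ≤ n') (g : Fin n' × Fin n × Fin n → S)
    (hg : ∀ (t : Fin n') (i j : Fin n), d ≤ (t : ℕ) → g (t, i, j) = if i = j then 1 else 0) :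
    aeval g (immPoly n n' K) =
      aeval (fun v : Fin d × Fin n × Fin n => g (Fin.castLE hd v.1, v.2.1, v.2.2)) (immPoly n d K) := by
  rw [LayeredAutomaton.aeval_immPoly_eq_trace, LayeredAutomaton.aeval_immPoly_eq_trace]
  congr 1
  -- both products as products over `List.range`
  set F : ℕ → Matrix (Fin n) (Fin n) S := fun t =>
    if h : t < n' then Matrix.of fun i j => g (⟨t, h⟩, i, j) else 1 with hF
  have h1 : ((List.finRange n').map fun t : Fin n' => Matrix.of fun i j => g (t, i, j)) =
      (List.range n').map F := by
    rw [← List.map_coe_finRange_eq_range, List.map_map]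
    refine List.map_congr_left fun t _ => ?_
    simp [hF, t.2]
  have h2 : ((List.finRange d).map fun t : Fin d =>
      Matrix.of fun i j => g (Fin.castLE hd t, i, j)) = (List.range d).map F := by
    rw [← List.map_coe_finRange_eq_range, List.map_map]
    refine List.map_congr_left fun t _ => ?_
    have ht : (t : ℕ) < n' := lt_of_lt_of_le t.2 hd
    simp only [Function.comp_apply, hF, dif_pos ht]
    rfl
  rw [h1, h2]
  obtain ⟨j, rfl⟩ := Nat.exists_eq_add_of_le hd
  refine prod_map_range_eq_of_eq_one F d j fun t ht htn => ?_
  simp only [hF, dif_pos htn]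
  ext i j
  rw [Matrix.of_apply, hg ⟨t, htn⟩ i j ht, Matrix.one_apply]

end Padding

/-! ## §2 Affine forms; the word substitution placed by an embedding is affine -/

section Affine

variable {K : Type*} [CommRing K] {n : ℕ}

/-- `deg x_v ≤ 1` (also over the zero ring). [folklore] -/
theorem totalDegree_X_le_one {σ : Type*} (v : σ) : (X v : MvPolynomial σ K).totalDegree ≤ 1 := by
  rcases subsingleton_or_nontrivial K with hK | hK
  · simp [Subsingleton.elim (X v : MvPolynomial σ K) 0]
  · rw [totalDegree_X]

/-- The values of LST's substitution `ρ_w` are `0/1`-sums of variables, of degree `≤ 1`.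
[cite: LimayeSrinivasanTavenas2025, Lemma 8] -/
theorem totalDegree_wordSubst_le {d k : ℕ} (pos : Fin d → Bool)
    (hn : ∀ t ≤ d, 2 ^ overLen k pos t ≤ n) (v : Fin d × Fin n × Fin n) :
    (wordSubst k pos ℂ hn v).totalDegree ≤ 1 := by
  classical
  unfold wordSubst LayeredAutomaton.autSubst
  refine (totalDegree_finsetSum _ _).trans (Finset.sup_le fun b _ => ?_)
  split_ifs
  · exact totalDegree_X_le_one _
  · simp

/-- A polynomial of total degree `≤ 1` is the affine form `Σ_v c_v x_v + c_0` of its own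
coefficients. [folklore] -/
theorem eq_affine_of_totalDegree_le_one (p : MvPolynomial (Fin n) K) (hp : p.totalDegree ≤ 1) :
    p = ∑ v : Fin n, C (coeff (Finsupp.single v 1) p) * X v + C (coeff 0 p) := by
  classical
  ext m
  simp only [coeff_add, coeff_sum, coeff_C_mul, coeff_X, coeff_C, mul_ite, mul_one, mul_zero]
  by_cases hm0 : m = 0
  · subst hm0
    have h0 : (∑ v : Fin n, if Finsupp.single v 1 = (0 : Fin n →₀ ℕ) then
        coeff (Finsupp.single v 1) p else 0) = 0 :=
      Finset.sum_eq_zero fun v _ => if_neg (Finsupp.single_ne_zero.2 one_ne_zero)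
    rw [h0, if_pos rfl, zero_add]
  rw [if_neg (Ne.symm hm0), add_zero]
  by_cases hms : ∃ v : Fin n, Finsupp.single v 1 = m
  · obtain ⟨v, rfl⟩ := hms
    rw [Finset.sum_eq_single v, if_pos rfl]
    · intro v' _ hv'
      exact if_neg fun h => hv' (Finsupp.single_left_injective one_ne_zero h)
    · intro h; exact absurd (Finset.mem_univ v) h
  · have hsum : (∑ v : Fin n, if Finsupp.single v 1 = m then coeff (Finsupp.single v 1) p else 0) = 0 :=
      Finset.sum_eq_zero fun v _ => if_neg fun h => hms ⟨v, h⟩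
    rw [hsum]
    by_contra hne
    have hmem : m ∈ p.support := mem_support_iff.2 hne
    have hdeg : ∑ u ∈ m.support, m u ≤ 1 := (le_totalDegree hmem).trans hp
    -- a nonzero `m` of degree `≤ 1` is a `single v 1`
    obtain ⟨v, hv⟩ : ∃ v, m v ≠ 0 := by
      by_contra h
      simp only [not_exists, not_not] at h
      exact hm0 (Finsupp.ext h)
    apply hms ⟨v, ?_⟩
    have hvle : m v ≤ ∑ u ∈ m.support, m u :=
      Finset.single_le_sum (f := fun u => m u) (fun u _ => Nat.zero_le (m u))
        (Finsupp.mem_support_iff.2 hv)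
    have hmv : m v = 1 := by omega
    ext u
    by_cases hu : u = v
    · subst hu; simp [hmv]
    · rw [Finsupp.single_apply, if_neg (Ne.symm hu)]
      by_contra hu0
      have hsub : ({u, v} : Finset (Fin n)) ⊆ m.support := by
        intro x hx
        simp only [Finset.mem_insert, Finset.mem_singleton] at hx
        rcases hx with rfl | rfl
        · exact Finsupp.mem_support_iff.2 (fun h0 => hu0 h0.symm)
        · exact Finsupp.mem_support_iff.2 hv
      have hule : m u + m v ≤ ∑ w ∈ m.support, m w :=
        calc m u + m v = ∑ w ∈ ({u, v} : Finset (Fin n)), m w := (Finset.sum_pair hu).symm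
          _ ≤ ∑ w ∈ m.support, m w :=
            Finset.sum_le_sum_of_subset_of_nonneg hsub (fun _ _ _ => Nat.zero_le _)
      omega

/-- An affine form has total degree `≤ 1`. [folklore] -/
theorem totalDegree_affine_le (a : Option (Fin n) → K) :
    (∑ v : Fin n, C (a (some v)) * X v + C (a none) : MvPolynomial (Fin n) K).totalDegree ≤ 1 := by
  refine (totalDegree_add _ _).trans (max_le ?_ (by simp))
  refine (totalDegree_finsetSum _ _).trans (Finset.sup_le fun v _ => ?_)
  refine (totalDegree_mul _ _).trans ?_
  rw [totalDegree_C, zero_add]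
  exact totalDegree_X_le_one v

/-- `L(Σ_v a_v x_v + a_0) ≤ 2n + 1`. [cite: Burgisser2000, §2.1] -/
theorem complexity_affine_le (a : Option (Fin n) → ℂ) :
    complexity (∑ v : Fin n, C (a (some v)) * X v + C (a none) : MvPolynomial (Fin n) ℂ) ≤
      2 * n + 1 := by
  classical
  refine (complexity_add_le_holds _ _).trans ?_
  rw [complexity_C_holds, add_zero]
  refine Nat.add_le_add_right ((complexity_finset_sum_le _ _).trans ?_) 1
  calc ∑ v : Fin n, complexity (C (a (some v)) * X v : MvPolynomial (Fin n) ℂ)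
          + (Finset.univ : Finset (Fin n)).card
      ≤ ∑ _v : Fin n, 1 + (Finset.univ : Finset (Fin n)).card := by
        refine Nat.add_le_add_right (Finset.sum_le_sum fun v _ => ?_) _
        have h := complexity_mul_le_holds (k := ℂ) (C (a (some v)) : MvPolynomial (Fin n) ℂ) (X v)
        rw [complexity_C_holds, complexity_X_holds (k := ℂ) v] at h
        simpa using h
    _ = 2 * n := by simp [two_mul]

/-- **The LST substitution placed by an embedding, padded by identity layers** — layer `t < d`:
`x^{(t)}_{ij} ↦ e_*(ρ_w(x^{(t)}_{ij}))`; layer `t ≥ d`: `x^{(t)}_{ij} ↦ δ_{ij}` — turns `IMM_{n,n}`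
into the placed word polynomial `e_*(P_w)`. [cite: LimayeSrinivasanTavenas2025, Lemma 8] -/
theorem aeval_placedSubst_immPoly {d : ℕ} (k : ℕ) (pos : Fin d → Bool) (hd : 1 ≤ d) (hdn : d ≤ n)
    (hn : ∀ t ≤ d, 2 ^ overLen k pos t ≤ n) (e : (Σ i : Fin d, BlockVar k pos i) ↪ Fin n) :
    aeval (fun v : Fin n × Fin n × Fin n =>
        if h : (v.1 : ℕ) < d then rename e (wordSubst k pos ℂ hn (⟨v.1, h⟩, v.2.1, v.2.2))
        else if v.2.1 = v.2.2 then (1 : MvPolynomial (Fin n) ℂ) else 0) (immPoly n n ℂ) =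
      rename e (wordPoly k pos ℂ) := by
  have hfun : (fun v : Fin d × Fin n × Fin n =>
      (fun w : Fin n × Fin n × Fin n =>
        if h : (w.1 : ℕ) < d then rename e (wordSubst k pos ℂ hn (⟨w.1, h⟩, w.2.1, w.2.2))
        else if w.2.1 = w.2.2 then (1 : MvPolynomial (Fin n) ℂ) else 0)
        (Fin.castLE hdn v.1, v.2.1, v.2.2)) =
      fun v => rename e (wordSubst k pos ℂ hn v) := by
    funext v
    obtain ⟨t, i, j⟩ := v
    have ht : ((Fin.castLE hdn t : Fin n) : ℕ) < d := t.2
    simp only [dif_pos ht]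
    rfl
  rw [aeval_immPoly_pad (K := ℂ) hdn _ (fun t i j ht => by simp only [dif_neg (not_lt.2 ht)]), hfun,
    ← comp_aeval, AlgHom.comp_apply, aeval_wordSubst_immPoly k pos ℂ hn (by omega)]

/-- Hence: some coefficient tensor `A` turns the AFFINE substitution `x^{(t)}_{ij} ↦ Σ_v A_{tij,v} x_v
+ A_{tij,∗}` of `IMM_{n,n}` into `e_*(P_w)`. [cite: LimayeSrinivasanTavenas2025, Lemma 8] -/
theorem exists_affine_specialisation {d : ℕ} (k : ℕ) (pos : Fin d → Bool) (hd : 1 ≤ d) (hdn : d ≤ n)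
    (hn : ∀ t ≤ d, 2 ^ overLen k pos t ≤ n) (e : (Σ i : Fin d, BlockVar k pos i) ↪ Fin n) :
    ∃ A : (Fin n × Fin n × Fin n) × Option (Fin n) → ℂ,
      aeval (fun v : Fin n × Fin n × Fin n =>
          (∑ u : Fin n, C (A (v, some u)) * X u + C (A (v, none)) : MvPolynomial (Fin n) ℂ))
        (immPoly n n ℂ) = rename e (wordPoly k pos ℂ) := by
  classical
  -- the placed substitution, layer by layer
  obtain ⟨g, hg⟩ : ∃ g : Fin n × Fin n × Fin n → MvPolynomial (Fin n) ℂ, g = fun v =>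
      if h : (v.1 : ℕ) < d then rename e (wordSubst k pos ℂ hn (⟨v.1, h⟩, v.2.1, v.2.2))
      else if v.2.1 = v.2.2 then (1 : MvPolynomial (Fin n) ℂ) else 0 := ⟨_, rfl⟩
  have hdeg : ∀ v, (g v).totalDegree ≤ 1 := by
    intro v
    rw [hg]
    dsimp only
    split_ifs with h
    · exact (totalDegree_rename_le _ _).trans (totalDegree_wordSubst_le pos hn _)
    · simp
    · simp
  refine ⟨fun p => Option.elim p.2 (coeff 0 (g p.1)) (fun u => coeff (Finsupp.single u 1) (g p.1)), ?_⟩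
  have hfun : (fun v : Fin n × Fin n × Fin n =>
      (∑ u : Fin n, C ((fun p : (Fin n × Fin n × Fin n) × Option (Fin n) =>
          Option.elim p.2 (coeff 0 (g p.1)) (fun u => coeff (Finsupp.single u 1) (g p.1)))
          (v, some u)) * X u +
        C ((fun p : (Fin n × Fin n × Fin n) × Option (Fin n) =>
          Option.elim p.2 (coeff 0 (g p.1)) (fun u => coeff (Finsupp.single u 1) (g p.1)))
          (v, none)) : MvPolynomial (Fin n) ℂ)) = g := by
    funext v
    simp only [Option.elim]
    exact (eq_affine_of_totalDegree_le_one (g v) (hdeg v)).symm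
  rw [hfun, hg]
  exact aeval_placedSubst_immPoly k pos hd hdn hn e

end Affine


end ProductDepthWallUniversal

end Summit.ValiantsHypothesis.ValiantsHypothesis.Theorems.BarrierLeverDefinableEquations
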